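import Summits.BirchSwinnertonDyer.BirchSwinnertonDyer.Theorems.GenusKolyvaginAtTwoK4NegOrdinaryWitnessUnramified
import Literature.NumberTheory.EllipticCurves.TwoAdicImageSurjectivityModTwoProofs
import Literature.NumberTheory.EllipticCurves.KodairaNeronUnramifiedInertiaProofs
import Literature.NumberTheory.EllipticCurves.UnramifiedLayerRootsProofs
import Literature.NumberTheory.GaloisRepresentations.InertiaRootsOfUnity
import HarnessLib

/-!
# Route `GenusKolyvaginAtTwo`, K₄⁻ kernel `K4Neg` (stmt-BirchSwinnertonDyer-31526), LINE 34 «twin_bsd_road⁻» v1.5 (F4ᵖᵍ census):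
# THE DISCRIMINANT DICTIONARY FOR THE ORDINARY WITNESS — `Δ ≡ 1 (mod 4)` ⟹ `E[2]` is unramified at the good ordinary place over `2`

Width seat `bsd-line-gk2-p5` g42 (cell `bsd-f1-sign2`), WIDTH-5 attach on route `GenusKolyvaginAtTwo` rev 59, lane `(NPh_K)` off
the cut.  `--supports stmt-BirchSwinnertonDyer-31526 --as helper`.  THEOREMS ONLY (no definition, no named fact, no `sorry`); standard
axioms.  **BSD is NOT proved by this file; `K4Neg` is NOT proved; no item is closed by it.**

WHAT.  The companion file `…K4NegOrdinaryWitnessUnramified` (★★★ `not_mem_selmerLocalKer_two_of_unramified_twoTorsion`, ★★★′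
`offCutNonPhantomAtTwo_of_unramified_twoTorsion`) proved: at a place `v ∋ 2` of GOOD ORDINARY reduction with `E[2]` UNRAMIFIED at `v`,
the Lawson–Wuthrich class is not a Kummer class at `v`, whence `(NPh_K)` at every `2`-split Heegner frame.  Its hypothesis
`hunr : ∀ τ ∈ I_{ℚ_v}, res τ ∈ Γ_{ℚ(E[2])}` was left to the reader of the census as «`Δ_min ≡ 1 (mod 4)`».  This file PROVES that
dictionary entry, for ANY model `W/ℚ` whose discriminant is `Δ_W = 1 + 4m` with `m ∈ ℤ`:
* §1 ★ `smul_eq_self_of_mem_absInertia_of_mul_self_eq_add` — over any non-archimedean local field `F` with `‖2‖ < 1`: an inertia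
  element FIXES every root `b ∈ F̄` of an Artin–Schreier-type quadratic `b² = b + c` (`‖c‖ ≤ 1`, `c` fixed): `‖b‖ ≤ 1` (ultrametric),
  the other root is `1 - b`, and `‖(1 - b) - b‖ = ‖1 - 2b‖ = 1` is not `< 1` (Neukirch's inertia criterion `mem_absInertia_iff_algNorm`).
* §2 ★★ `absGaloisRestrict_smul_delta_eq_of_mem_absInertia` — for `W/ℚ` with `Δ_W = 1 + 4m`: every inertia element at a place with
  `‖2‖_v < 1` fixes the Dokchitser letter-discriminant `δ = ∏_{i<j}(x_i - x_j)` (`Δ = 16δ²`, tree `algebraMap_Δ`): apply §1 to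
  `b = (1 + 4δ)/2`, `b² = b + m`, transported along the chosen embedding `ℚ̄ → ℚ̄_v` (`absGaloisRestrict_apply_smul`).
* §3 ★★★ `torsionFixing_two_of_mem_absInertia_of_Δ_eq` — **THE DICTIONARY**: `v ∋ 2` of good ORDINARY reduction and `Δ_W = 1 + 4m`
  ⟹ `∀ τ ∈ I_{ℚ_v}, res τ ∈ Γ_{ℚ(E[2])}`.  Proof: `res τ` permutes the letters `{T₀, T₁, T₂}` EVENLY (§2 and Dokchitser–Dokchitser's
  `σδ = sign(σ)δ`, tree `smul_delta`) and FIXES the letter spanning the kernel-of-reduction line (`goodReduction_reduction_line`: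
  inertia does not move reductions, `#(ker ∩ E[2]) = 2`); an even permutation of three letters with a fixed letter is the identity.
* §4 ★★★★ `not_mem_selmerLocalKer_two_of_Δ_eq`, ★★★★′ `offCutNonPhantomAtTwo_of_Δ_eq` — the companion's ★★★/★★★′ with `hunr`
  DISCHARGED: `ρ̄_{W,2}`, `ρ_{W,4}` onto (resp. the whole `2`-adic tower onto), `v ∋ 2` good ordinary, `Δ_W = 1 + 4m` ⟹ the Lawson–Wuthrich
  class is not a Kummer class at `v` ⟹ `(NPh_K)` at every `2`-split admissible frame `(K, 1)`.
READING (LINE 34 v1.5 census; nothing closed).  With gk2-p5 g41 (multiplicative at `2`) and gk2-p4 g32 (`Δ > 0`) this makes the NPh road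
KERNEL on the off-cut cells «`E` good ordinary at `2` with `Δ_min ≡ 1 (mod 4)`» from the discriminant alone (for a minimal model good and
ordinary at `2` means `Δ_min` odd with `a₁` odd; the complementary good-ordinary cells `Δ_min ≡ 3 (mod 4)` have `ℚ₂(√Δ)` ramified and
NO inertial witness of this kind — there `res(I_{ℚ₂})` meets `Γ_{ℚ(E[2])}` in `χ₄ = 1` only).  BSD is NOT proved by any of this.

References: [DokchitserDokchitserMathZ2012] Theorem (1), proof; [NeukirchANT1999] Ch. II (9.3); [SerreInventiones1972] §1.11;
[SilvermanAEC2009] VII.2.1, VIII.§1; [LawsonWuthrich2016] §3, §7.1.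
-/

set_option linter.dupNamespace false -- `Summit.<P>.<Sub>` repeats `BirchSwinnertonDyer` (D-0017)
set_option autoImplicit false

namespace Summit.BirchSwinnertonDyer.BirchSwinnertonDyer.Theorems.GenusExact.Lw2PhantomExclusion.OrdinaryWitness

/-! ## §0 A finite fact about `S₃` (kernel-decided, outside `Classical`) -/

/-- An EVEN permutation of three letters with a FIXED letter is the identity (the even permutations of `{0,1,2}` are `1` and the
two `3`-cycles, which move every letter). [folklore] -/
theorem perm_three_eq_one_of_sign_eq_one_of_apply_eq :
    ∀ g : Equiv.Perm (Fin 3), Equiv.Perm.sign g = 1 → ∀ c : Fin 3, g c = c → g = 1 := by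
  decide

end Summit.BirchSwinnertonDyer.BirchSwinnertonDyer.Theorems.GenusExact.Lw2PhantomExclusion.OrdinaryWitness

noncomputable section

open scoped Classical NNReal NumberField

namespace Summit.BirchSwinnertonDyer.BirchSwinnertonDyer.Theorems.GenusExact.Lw2PhantomExclusion.OrdinaryWitness

open WeierstrassCurve Field NumberField IsDedekindDomain
open Literature.NumberTheory.GaloisRepresentations Literature.NumberTheory.EllipticCurves
open Literature.NumberTheory.GaloisRepresentations.IsNonarchimedeanLocalField
open Literature.NumberTheory IsDedekindDomain.HeightOneSpectrum
open Literature.NumberTheory.EllipticCurves.DokchitserDokchitser2012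

/-! ## §1 ★ Inertia fixes the roots of `b² = b + c` when `‖2‖ < 1` -/

section Local

variable {F : Type*} [Field F] [ValuativeRel F] [TopologicalSpace F] [IsNonarchimedeanLocalField F]

/-- `‖n‖ ≤ 1` for every natural number `n`, in `F̄` over a non-archimedean local field (ultrametric inequality and `‖1‖ = 1`).
[cite: NeukirchANT1999, Ch. II (4.8)] -/
theorem algNorm_natCast_le_one (n : ℕ) : algNorm F (n : AlgebraicClosure F) ≤ 1 := by
  induction n with
  | zero => simp
  | succ n ih =>
    rw [Nat.cast_succ]
    exact (algNorm_add_le _ _).trans (max_le ih (by rw [algNorm_one]))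

/-- `‖m‖ ≤ 1` for every integer `m`, in `F̄` over a non-archimedean local field. [cite: NeukirchANT1999, Ch. II (4.8)] -/
theorem algNorm_intCast_le_one (m : ℤ) : algNorm F (m : AlgebraicClosure F) ≤ 1 := by
  obtain ⟨n, rfl | rfl⟩ := Int.eq_nat_or_neg m
  · rw [Int.cast_natCast]; exact algNorm_natCast_le_one n
  · rw [Int.cast_neg, Int.cast_natCast, algNorm_neg]; exact algNorm_natCast_le_one n

/-- ★ **Inertia fixes the roots of an Artin–Schreier-type quadratic.**  `F` a non-archimedean local field with `‖2‖ < 1` (residue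
characteristic `2`), `τ ∈ I_F`, and `b ∈ F̄` with `b² = b + c` where `‖c‖ ≤ 1` and `τ c = c`.  Then `τ b = b`.  Indeed `‖b‖ ≤ 1`
(`‖b‖² = ‖b + c‖ ≤ max(‖b‖, 1)`); `τ b` is again a root, so `τ b ∈ {b, 1 - b}`; and `τ b = 1 - b` would give `‖τ b - b‖ = ‖1 - 2b‖ = 1`,
against Neukirch's inertia criterion `‖τ b - b‖ < 1` (tree `mem_absInertia_iff_algNorm`).  (The extension `F(b)/F` is unramified: the
reduction of `x² - x - c` is separable.) [cite: NeukirchANT1999, Ch. II (9.3) Definition (inertia group), (4.8)] -/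
theorem smul_eq_self_of_mem_absInertia_of_mul_self_eq_add
    {τ : absoluteGaloisGroup F} (hτ : τ ∈ absInertia F) (h2 : algNorm F 2 < 1)
    {c : AlgebraicClosure F} (hc1 : algNorm F c ≤ 1) (hτc : τ • c = c)
    {b : AlgebraicClosure F} (hb : b * b = b + c) : τ • b = b := by
  -- `‖b‖ ≤ 1`
  have hb1 : algNorm F b ≤ 1 := by
    by_contra hlt
    rw [not_le] at hlt
    have hsq : algNorm F b * algNorm F b ≤ max (algNorm F b) (algNorm F c) := by
      rw [← algNorm_mul, hb]; exact algNorm_add_le b c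
    have hmax : max (algNorm F b) (algNorm F c) ≤ algNorm F b := max_le le_rfl (hc1.trans hlt.le)
    have h := hsq.trans hmax
    nlinarith [h, hlt]
  -- `τ • b` is a root of the same quadratic
  have hb' : (τ • b) * (τ • b) = τ • b + c := by
    have h := congrArg (τ • ·) hb
    simpa only [smul_mul', smul_add, hτc] using h
  -- hence `τ • b = b` or `τ • b = 1 - b`
  have hprod : (τ • b - b) * (τ • b - (1 - b)) = 0 := by linear_combination hb' - hb
  rcases mul_eq_zero.mp hprod with h | h
  · exact sub_eq_zero.mp h
  · exfalso
    have h1 : τ • b - b = 1 + -(2 * b) := by linear_combination h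
    have hlt : algNorm F (τ • b - b) < 1 := (mem_absInertia_iff_algNorm.mp hτ) b hb1
    have h2b : algNorm F (-(2 * b)) < algNorm F 1 := by
      rw [algNorm_neg, algNorm_mul, algNorm_one]
      calc algNorm F 2 * algNorm F b ≤ algNorm F 2 * 1 := mul_le_mul_of_nonneg_left hb1 (algNorm_nonneg _)
        _ = algNorm F 2 := mul_one _
        _ < 1 := h2
    rw [h1, algNorm_add_eq_left h2b, algNorm_one] at hlt
    exact lt_irrefl _ hlt

end Local

/-! ## §2 ★★ Transport: inertia at a place with `‖2‖ < 1` fixes `δ` when `Δ = 1 + 4m` -/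

section Delta

variable (W : WeierstrassCurve ℚ) [W.IsElliptic]

/-- ★★ **`Δ_W = 1 + 4m` ⟹ inertia fixes `δ`.**  `W/ℚ` elliptic with `Δ_W = 1 + 4m` (`m ∈ ℤ`), `v` a place with `‖2‖_v < 1`, `τ ∈ I_{ℚ_v}`.
Then `res τ` (the tree's `absGaloisRestrict`, along the chosen embedding `ι : ℚ̄ → ℚ̄_v`) FIXES the letter-discriminant
`δ = (x₀ - x₁)(x₀ - x₂)(x₁ - x₂)` of Dokchitser–Dokchitser: `u = 4δ` has `u² = Δ_W` (tree `algebraMap_Δ`), so `b = (1 + ι u)/2` satisfies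
`b² = b + m` and is fixed by `τ` (§1); hence `τ (ι u) = ι u`, i.e. `ι (res τ · u) = ι u` (`absGaloisRestrict_apply_smul`), `res τ · u = u`.
(«`ℚ_v(√Δ)/ℚ_v` is unramified for `Δ ≡ 1 (mod 4)`».) [cite: DokchitserDokchitserMathZ2012, Theorem (1), proof (ℚ(E[2]) ⊃ ℚ(√Δ))]
[cite: NeukirchANT1999, Ch. II (9.3)] -/
theorem absGaloisRestrict_smul_delta_eq_of_mem_absInertia (h2 : (2 : ℚ) ≠ 0)
    (v : HeightOneSpectrum (𝓞 ℚ)) (h2v : algNorm (v.adicCompletion ℚ) 2 < 1)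
    {m : ℤ} (hΔ : W.Δ = 1 + 4 * m)
    {τ : absoluteGaloisGroup (v.adicCompletion ℚ)} (hτ : τ ∈ absInertia (v.adicCompletion ℚ)) :
    absGaloisRestrict ℚ (v.adicCompletion ℚ) τ • delta W h2 = delta W h2 := by
  -- `2 ≠ 0` in `ℚ̄_v` (no `CharZero` instance is put on `ℚ_v`: that would change the `ℚ`-algebra structure found by inference)
  have h2F : (2 : AlgebraicClosure (v.adicCompletion ℚ)) ≠ 0 := by
    intro h0
    apply two_ne_zero (α := ℚ)
    apply (algebraMap ℚ (AlgebraicClosure (v.adicCompletion ℚ))).injective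
    rw [map_ofNat, h0, map_zero]
  -- `u = 4δ` has `u² = Δ = 1 + 4m`
  have hu : (4 * delta W h2) * (4 * delta W h2) = 1 + 4 * (m : AlgebraicClosure ℚ) := by
    have h := algebraMap_Δ W h2
    rw [hΔ, map_add, map_one, map_mul, map_intCast, map_ofNat] at h
    linear_combination -h
  -- transport along `ι : ℚ̄ → ℚ̄_v`
  have hU : absClosureEmbedding ℚ (v.adicCompletion ℚ) (4 * delta W h2) *
      absClosureEmbedding ℚ (v.adicCompletion ℚ) (4 * delta W h2) =
        1 + 4 * (m : AlgebraicClosure (v.adicCompletion ℚ)) := by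
    have h := congrArg (absClosureEmbedding ℚ (v.adicCompletion ℚ)) hu
    simpa only [map_mul, map_add, map_one, map_ofNat, map_intCast] using h
  -- the Artin–Schreier root `b = (1 + ι u)/2`, `b² = b + m`
  have hb : (1 + absClosureEmbedding ℚ (v.adicCompletion ℚ) (4 * delta W h2)) / 2 *
      ((1 + absClosureEmbedding ℚ (v.adicCompletion ℚ) (4 * delta W h2)) / 2) =
        (1 + absClosureEmbedding ℚ (v.adicCompletion ℚ) (4 * delta W h2)) / 2 +
          (m : AlgebraicClosure (v.adicCompletion ℚ)) := by
    field_simp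
    linear_combination hU
  have hτm : τ • ((m : ℤ) : AlgebraicClosure (v.adicCompletion ℚ)) = m := by
    have h := (show AlgebraicClosure (v.adicCompletion ℚ) ≃ₐ[v.adicCompletion ℚ] AlgebraicClosure (v.adicCompletion ℚ)
      from τ).commutes (m : v.adicCompletion ℚ)
    rwa [map_intCast] at h
  have hτb := smul_eq_self_of_mem_absInertia_of_mul_self_eq_add hτ h2v (algNorm_intCast_le_one m) hτm hb
  -- so `τ` fixes `ι u = 2b - 1`
  have hτ1 : τ • (1 : AlgebraicClosure (v.adicCompletion ℚ)) = 1 := smul_one τ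
  have hτU : τ • absClosureEmbedding ℚ (v.adicCompletion ℚ) (4 * delta W h2) =
      absClosureEmbedding ℚ (v.adicCompletion ℚ) (4 * delta W h2) := by
    have hUb : absClosureEmbedding ℚ (v.adicCompletion ℚ) (4 * delta W h2) =
        (1 + absClosureEmbedding ℚ (v.adicCompletion ℚ) (4 * delta W h2)) / 2 +
          (1 + absClosureEmbedding ℚ (v.adicCompletion ℚ) (4 * delta W h2)) / 2 - 1 := by
      field_simp
      ring
    rw [hUb, smul_sub, smul_add, hτb, hτ1]
  -- transport back: `ι (res τ • u) = τ • ι u = ι u`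
  have hσu : absGaloisRestrict ℚ (v.adicCompletion ℚ) τ • (4 * delta W h2) = 4 * delta W h2 := by
    apply (absClosureEmbedding ℚ (v.adicCompletion ℚ)).toRingHom.injective
    change absClosureEmbedding ℚ (v.adicCompletion ℚ) _ = absClosureEmbedding ℚ (v.adicCompletion ℚ) _
    rw [absGaloisRestrict_apply_smul]
    exact hτU
  -- `res τ • 4 = 4`, cancel
  have h4fix : absGaloisRestrict ℚ (v.adicCompletion ℚ) τ • (4 : AlgebraicClosure ℚ) = 4 := by
    have h := (show AlgebraicClosure ℚ ≃ₐ[ℚ] AlgebraicClosure ℚ from absGaloisRestrict ℚ (v.adicCompletion ℚ) τ).commutes 4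
    rwa [map_ofNat] at h
  have h4 : (4 : AlgebraicClosure ℚ) ≠ 0 := by norm_num
  rw [smul_mul', h4fix] at hσu
  exact mul_left_cancel₀ h4 hσu

end Delta

/-! ## §3 ★★★ The dictionary: good ordinary at `v ∋ 2` and `Δ = 1 + 4m` ⟹ `E[2]` unramified at `v` -/

section Dictionary

variable (W : WeierstrassCurve ℚ) [W.IsElliptic]

/-- ★★★ **THE DISCRIMINANT DICTIONARY.**  `W/ℚ` elliptic (any model) with `Δ_W = 1 + 4m`, `m ∈ ℤ`; `v` the place over `2`, of GOOD
ORDINARY reduction.  Then **`E[2]` is unramified at `v`**: every `τ ∈ I_{ℚ_v}` has `res τ ∈ Γ_{ℚ(E[2])}`.  Proof: `res τ` permutes the three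
letters `T₀, T₁, T₂` of `E[2] ∖ O`; the permutation is EVEN since `res τ` fixes `δ` (§2, `σδ = sign(σ)δ` — Dokchitser–Dokchitser, tree
`smul_delta`), and it FIXES the letter spanning the kernel-of-reduction line `Λ = ker(red) ∩ E[2]` (a line for ordinary reduction, and
inertia does not move reductions — tree `goodReduction_reduction_line`); an even permutation of three letters fixing one is trivial (§0).
[cite: DokchitserDokchitserMathZ2012, Theorem (1), proof (ℚ(E[2]) ⊃ ℚ(√Δ))] [cite: SerreInventiones1972, §1.11 Prop. 11 and Cor.]
[cite: SilvermanAEC2009, VII.2.1, VIII.§1] -/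
theorem torsionFixing_two_of_mem_absInertia_of_Δ_eq
    (v : HeightOneSpectrum (𝓞 ℚ)) (hv2 : ((2 : ℕ) : 𝓞 ℚ) ∈ v.asIdeal) (hgood : W.HasGoodReductionAt v)
    (hord : ¬ (((2 : ℕ) : ℤ) ∣ W.frobeniusTraceAt v)) {m : ℤ} (hΔ : W.Δ = 1 + 4 * m) :
    ∀ τ ∈ absInertia (v.adicCompletion ℚ), absGaloisRestrict ℚ (v.adicCompletion ℚ) τ ∈ torsionFixing W (2 : ℤ) := by
  intro τ hτ
  haveI : Fact (Nat.Prime 2) := ⟨Nat.prime_two⟩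
  have h2 : (2 : ℚ) ≠ 0 := two_ne_zero
  -- the local good-reduction frame and the reduction map on `E(ℚ̄)`
  obtain ⟨w, hw, φ, Φ₀, hX, _, hΔO, hΦ₀⟩ := exists_goodReduction_localModel W v hgood
  -- `‖2‖_v < 1`
  have h2v : algNorm (v.adicCompletion ℚ) 2 < 1 := by
    have h := spectralValuation_algebraMap_ringOfIntegers_lt_one (v := v) hw hv2
    rw [map_natCast, Nat.cast_ofNat] at h
    exact (spectralValuation_lt_one_iff_algNorm_lt_one hw _).mp h
  set f : geomPoints W →+ (((W.localMinimalIntegralModel v).map φ).map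
      (IsLocalRing.residue w.valuationSubring)).toAffine.Point :=
    (goodReductionHom ((W.localMinimalIntegralModel v).map φ)
      (Valuation.valuationSubring.integers w) hΔO).comp
      (((Φ₀.trans (Affine.Point.congrEquiv hX)).toAddMonoidHom).comp
        (pointsMap W (v.adicCompletion ℚ))) with hfdef
  have hf : ∀ a, f a = goodReductionHom ((W.localMinimalIntegralModel v).map φ)
      (Valuation.valuationSubring.integers w) hΔO
      (Affine.Point.congrEquiv hX (Φ₀ (pointsMap W (v.adicCompletion ℚ) a))) := fun a ↦ rfl
  obtain ⟨-, hinv, hcard⟩ := goodReduction_reduction_line W 2 v hv2 hgood hord hw hΔO hX Φ₀ hΦ₀ f hf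
  set σ := absGaloisRestrict ℚ (v.adicCompletion ℚ) τ with hσdef
  -- ### the kernel-of-reduction LINE `Λ = ker f ∩ E[2] = {0, T₀}`
  have hcard2 : Nat.card ↥(f.ker ⊓ geomTorsion W (2 : ℤ)) = 2 := hcard
  obtain ⟨u₁, u₂, hne, huniv⟩ := Nat.card_eq_two_iff.mp hcard2
  have hmemΛ : ∀ S : geomTorsion W (2 : ℤ), (S : geomPoints W) ∈ f.ker →
      ∃ u : ↥(f.ker ⊓ geomTorsion W (2 : ℤ)), (u : geomPoints W) = S := fun S hS ↦
    ⟨⟨S, AddSubgroup.mem_inf.mpr ⟨hS, S.2⟩⟩, rfl⟩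
  have htwo : ∀ u : ↥(f.ker ⊓ geomTorsion W (2 : ℤ)), u = u₁ ∨ u = u₂ := fun u ↦ by
    have hu : u ∈ ({u₁, u₂} : Set _) := by rw [huniv]; exact Set.mem_univ u
    simpa using hu
  obtain ⟨T₀', hT₀'ne, hT₀'all⟩ : ∃ T : ↥(f.ker ⊓ geomTorsion W (2 : ℤ)), T ≠ 0 ∧
      ∀ u : ↥(f.ker ⊓ geomTorsion W (2 : ℤ)), u = 0 ∨ u = T := by
    by_cases h1 : u₁ = 0
    · refine ⟨u₂, fun h ↦ hne (h1.trans h.symm), fun u ↦ ?_⟩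
      rcases htwo u with h | h
      · exact Or.inl (h.trans h1)
      · exact Or.inr h
    · refine ⟨u₁, h1, fun u ↦ ?_⟩
      rcases htwo u with h | h
      · exact Or.inr h
      · rcases htwo 0 with h0 | h0
        · exact absurd h0.symm h1
        · exact Or.inl (h.trans h0.symm)
  let T₀ : geomTorsion W (2 : ℤ) := ⟨(T₀' : geomPoints W), (AddSubgroup.mem_inf.mp T₀'.2).2⟩
  have hT₀ : T₀ ≠ 0 := by
    intro h
    apply hT₀'ne
    apply Subtype.ext
    have h' : ((T₀ : geomTorsion W (2 : ℤ)) : geomPoints W) = ((0 : geomTorsion W (2 : ℤ)) : geomPoints W) :=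
      congrArg Subtype.val h
    exact h'
  have hline : ∀ S : geomTorsion W (2 : ℤ), (S : geomPoints W) ∈ f.ker → S = 0 ∨ S = T₀ := by
    intro S hS
    obtain ⟨u, hu⟩ := hmemΛ S hS
    rcases hT₀'all u with h | h
    · left
      exact Subtype.ext (by rw [← hu, h]; rfl)
    · right
      exact Subtype.ext (by rw [← hu, h])
  -- ### inertia FIXES `T₀`: `σ T₀ ∈ Λ ∖ 0`
  have hσT₀ : σ • T₀ = T₀ := by
    have hmem : ((σ • T₀ : geomTorsion W (2 : ℤ)) : geomPoints W) ∈ f.ker := by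
      rw [AddMonoidHom.mem_ker, AddSubgroup.torsionBy.coe_smul, hσdef, hinv τ hτ]
      exact (AddMonoidHom.mem_ker).mp (AddSubgroup.mem_inf.mp T₀'.2).1
    rcases hline (σ • T₀) hmem with h0 | h0
    · exfalso
      apply hT₀
      rw [← rho_apply W σ T₀] at h0
      exact (rho W σ).map_eq_zero_iff.mp h0
    · exact h0
  -- ### so `permGal σ` fixes the letter of `T₀` …
  obtain ⟨i₀, hi₀⟩ : ∃ i, T₀ = T W h2 i := (eq_zero_or_eq_T W h2 T₀).resolve_left hT₀
  have hfix : permGal W h2 σ i₀ = i₀ := T_injective W h2 (by rw [T_permGal, ← hi₀, hσT₀])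
  -- ### … and is EVEN: `σ δ = δ`
  have hδ := absGaloisRestrict_smul_delta_eq_of_mem_absInertia W h2 v h2v hΔ hτ
  rw [← hσdef] at hδ
  have hsign : Equiv.Perm.sign (permGal W h2 σ) = 1 := by
    rcases Int.units_eq_one_or (Equiv.Perm.sign (permGal W h2 σ)) with h | h
    · exact h
    · exfalso
      have hsd := smul_delta W h2 σ
      rw [h, hδ] at hsd
      simp only [Units.val_neg, Units.val_one, Int.cast_neg, Int.cast_one, neg_mul, one_mul] at hsd
      have h2' : (2 : AlgebraicClosure ℚ) ≠ 0 := two_ne_zero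
      have htwo : (2 : AlgebraicClosure ℚ) * delta W h2 = 0 := by linear_combination hsd
      exact delta_ne_zero W h2 ((mul_eq_zero.mp htwo).resolve_left h2')
  -- ### an even permutation of three letters with a fixed letter is trivial
  have hperm : permGal W h2 σ = 1 := perm_three_eq_one_of_sign_eq_one_of_apply_eq _ hsign i₀ hfix
  rw [mem_torsionFixing_iff]
  intro P
  rcases eq_zero_or_eq_T W h2 P with hP | ⟨i, hP⟩
  · rw [hP, ← rho_apply W σ 0, map_zero]
  · rw [hP, ← T_permGal, hperm, Equiv.Perm.one_apply]

end Dictionary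

/-! ## §4 ★★★★ The ordinary witness from the discriminant alone -/

section Witness

variable (W : WeierstrassCurve ℚ) [W.IsElliptic]

/-- ★★★★ **THE ORDINARY WITNESS FROM `Δ ≡ 1 (mod 4)`.**  `W/ℚ` elliptic with `ρ̄_{W,2}` and `ρ_{W,4}` onto, `v ∋ 2` of GOOD ORDINARY
reduction, `Δ_W = 1 + 4m` (`m ∈ ℤ`; e.g. `W` minimal with `Δ_min ≡ 1 (mod 4)`).  Then the Lawson–Wuthrich class (the class `x ≠ 0` of
`H¹(ℚ, E[2])` dying on `Γ_{ℚ(E[4])}`) is **NOT a Kummer class at `v`**: `x ∉ 𝓛_v = selmerLocalKer W ℚ_v 2` — the companion's ★★★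
`not_mem_selmerLocalKer_two_of_unramified_twoTorsion` with `E[2]` unramified supplied by §3.
[cite: LawsonWuthrich2016, §3, §7.1] [cite: SerreInventiones1972, §1.11 Prop. 11 and Cor.] [cite: DokchitserDokchitserMathZ2012, Theorem (1), proof] -/
theorem not_mem_selmerLocalKer_two_of_Δ_eq
    (hsurj : W.HasSurjectiveModNGaloisRep 2) (hsurj4 : W.HasSurjectiveModNGaloisRep 4)
    (v : HeightOneSpectrum (𝓞 ℚ)) (hv2 : ((2 : ℕ) : 𝓞 ℚ) ∈ v.asIdeal) (hgood : W.HasGoodReductionAt v)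
    (hord : ¬ (((2 : ℕ) : ℤ) ∣ W.frobeniusTraceAt v)) {m : ℤ} (hΔ : W.Δ = 1 + 4 * m)
    {x : galH1Torsion W (2 : ℤ)} (hx0 : x ≠ 0) (hx : ∀ h ∈ torsionFixing W (4 : ℤ), h1Eval W (2 : ℤ) x h = 0) :
    x ∉ selmerLocalKer W (v.adicCompletion ℚ) (2 : ℤ) :=
  not_mem_selmerLocalKer_two_of_unramified_twoTorsion W hsurj hsurj4 v hv2 hgood hord
    (torsionFixing_two_of_mem_absInertia_of_Δ_eq W v hv2 hgood hord hΔ) hx0 hx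

/-- ★★★★′ **`(NPh_K)` FROM `Δ ≡ 1 (mod 4)` AT A GOOD ORDINARY `2`** (F4″-shaped, LINE 34 v1.5 lane `(NPh_K)`): `W/ℚ` with the whole
`2`-adic tower onto, `v ∋ 2` of good ordinary reduction, `Δ_W = 1 + 4m`; `(K, 1)` any admissible frame with `2` split in `K`.  Then every
class of `H¹(K, E[2^L])` (`L ≥ 1`) dying on `Γ_{K(E[2^L])}` and locally Kummer above `2` vanishes.  The companion's ★★★′ with `hunr`
discharged by §3.  **BSD is not proved by this; `K4Neg` is not proved; nothing is closed.**
[cite: LawsonWuthrich2016, §3, §7.1] [cite: GrossLMS1991, §9 Prop. 9.1] [cite: DokchitserDokchitserMathZ2012, Theorem (1), proof] -/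
theorem offCutNonPhantomAtTwo_of_Δ_eq
    (hρ : ∀ n : ℕ, 0 < n → W.HasSurjectiveModNGaloisRep ((2 : ℤ) ^ n))
    (v : HeightOneSpectrum (𝓞 ℚ)) (hv2 : ((2 : ℕ) : 𝓞 ℚ) ∈ v.asIdeal) (hgood : W.HasGoodReductionAt v)
    (hord : ¬ (((2 : ℕ) : ℤ) ∣ W.frobeniusTraceAt v)) {m : ℤ} (hΔ : W.Δ = 1 + 4 * m)
    {K : Type} [Field K] [NumberField K] (hK : IsImaginaryQuadratic K) (hodd : Odd (NumberField.discr K))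
    (hnsq₁ : ¬ IsSquare ((NumberField.discr K : ℚ) * -|W.Δ|))
    (hnsq₂ : ¬ IsSquare ((NumberField.discr K : ℚ) * (-(2 * |W.Δ|))))
    (h2K : ((Ideal.span {(2 : ℤ)}).primesOver (𝓞 K)).ncard = 2) :
    ∀ (L : ℕ), 1 ≤ L → ∀ z : galH1Torsion (W.baseChange K) ((2 ^ L : ℕ) : ℤ),
      (∀ ρ' ∈ torsionFixing (W.baseChange K) ((2 ^ L : ℕ) : ℤ), h1Eval (W.baseChange K) ((2 ^ L : ℕ) : ℤ) z ρ' = 0) →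
      (∀ w : HeightOneSpectrum (𝓞 K), ((2 : ℕ) : 𝓞 K) ∈ w.asIdeal →
        z ∈ selmerLocalKer (W.baseChange K) (w.adicCompletion K) ((2 ^ L : ℕ) : ℤ)) → z = 0 :=
  offCutNonPhantomAtTwo_of_unramified_twoTorsion W hρ v hv2 hgood hord
    (torsionFixing_two_of_mem_absInertia_of_Δ_eq W v hv2 hgood hord hΔ) hK hodd hnsq₁ hnsq₂ h2K

end Witness

end Summit.BirchSwinnertonDyer.BirchSwinnertonDyer.Theorems.GenusExact.Lw2PhantomExclusion.OrdinaryWitness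

end
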